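import Summits.CriticalPhenomena.PercolationContinuityZ3.Theorems.PercNearOneGluingNoHeavyLowerTailKnQuestion8CoefficientwiseCoreClassKernelMixHubMaxSide
import HarnessLib

/-!
# μ₂ is an involution of the whole family 𝒱 (PATH LEMMA of hub-Kleitman, layer 3')

Support file (`--supports stmt-CriticalPhenomena-4575`, closed), prover `prim-cplus-coupling` (gen 51).  No definitions, no notations,
no named facts, no sorries; standard axioms.  Memo `prim-cplus-coupling/A5-COUPLING-gen51.md` §2 (Lemma 2.4).

Assembly of `…KernelMixHubMaxSide`, mirror image of `…KernelMixHubMu1`: the max-side toggle `t₂` of the augmented staircase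
theorem (toggle `N` on N-sets and on inner sets with cell in `B`; the column threshold `θ₂(min X) = min (om x) (betaP x - 1)`
on the other inner sets; `alphaP (min (X∖0))` on 0-sets; `∅ ↦ {N}` or `{db}`) satisfies, for `X ∈ 𝒱`:
`X ∆ {t₂ X} ∈ 𝒱`, `t₂ (X ∆ {t₂ X}) = t₂ X`, and `e ≤ t₂ X` for every `e ∈ X` (`hubStair_mu2_invol`).
The staircase enters through its column tops `om` and row starts `xi` (related by `hRrc`).
[cite: KozmaNitzan2024, Questions 8–9 (§5.5 p. 36) (context)]
-/

namespace Summit.CriticalPhenomena.PercolationContinuityZ3.Theorems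

open Finset
open scoped symmDiff

namespace Coefficientwise

/-- **μ₂ is an involution of 𝒱** (memo §2.4; max side of the augmented staircase theorem). [folklore] -/
theorem hubStair_mu2_invol (N : ℕ) (hN : 2 ≤ N)
    (xi om alphaP betaP : ℕ → ℕ) (sA dA bd db : ℕ) (A B : Finset (ℕ × ℕ))
    (hRrc : ∀ x y, 1 ≤ x → x ≤ y → y ≤ N - 1 → (xi y ≤ x ↔ y ≤ om x))
    (hom : ∀ x, 1 ≤ x → x ≤ N - 1 → x + 1 ≤ om x ∧ om x ≤ N)
    (hAcol : ∀ x y, (x, y) ∈ A ↔ 1 ≤ x ∧ x ≤ y ∧ y ≤ N - 1 ∧ y ≤ alphaP x)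
    (hAdiag : ∀ x, (x, x) ∈ A ↔ 1 ≤ x ∧ x ≤ sA)
    (hAdom : ∀ x, (x, x + 1) ∈ A ↔ 1 ≤ x ∧ x ≤ dA)
    (hsd : dA ≤ sA ∧ sA ≤ dA + 1) (hsN : sA ≤ N - 1)
    (halphaP : ∀ x, alphaP x ≤ N - 1)
    (hBcol : ∀ x y, (x, y) ∈ B ↔ 1 ≤ x ∧ x ≤ y ∧ y ≤ N - 1 ∧ betaP x ≤ y)
    (hBdiag : ∀ x, (x, x) ∈ B ↔ 1 ≤ x ∧ bd ≤ x ∧ x ≤ N - 1)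
    (hBdom : ∀ x, (x, x + 1) ∈ B ↔ 1 ≤ x ∧ db ≤ x ∧ x + 1 ≤ N - 1)
    (hbd : db ≤ bd ∧ bd ≤ db + 1) (hdb1 : 1 ≤ db) (hdbN : db ≤ N - 1) (hbdN : bd ≤ N)
    (hbetaP : ∀ x, 1 ≤ x → x ≤ N - 1 → x ≤ betaP x ∧ betaP x ≤ N)
    (hBR : ∀ x y, (x, y) ∈ B → xi y ≤ x)
    (V : Finset ℕ → Prop)
    (hV : ∀ X, V X ↔
      (X = ∅ ∨
      (X.Nonempty ∧ 0 ∉ X ∧ N ∉ X ∧ (∀ e ∈ X, e ≤ N - 1) ∧ ∀ h : X.Nonempty, xi (X.max' h) ≤ X.min' h) ∨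
      (0 ∈ X ∧ N ∉ X ∧ (∀ e ∈ X, e ≤ N - 1) ∧
        ((X = {0} ∧ sA = dA + 1) ∨ ∃ h : (X.erase 0).Nonempty, ((X.erase 0).min' h, (X.erase 0).max' h) ∈ A)) ∨
      (N ∈ X ∧ 0 ∉ X ∧ (∀ e ∈ X, e ≤ N) ∧
        ((X = {N} ∧ bd = db) ∨ ∃ h : (X.erase N).Nonempty, ((X.erase N).min' h, (X.erase N).max' h) ∈ B))))
    (t₂ : Finset ℕ → ℕ)
    (ht₂ : ∀ X, t₂ X =
      if N ∈ X then N
      else if 0 ∈ X then (if h : (X.erase 0).Nonempty then alphaP ((X.erase 0).min' h) else sA)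
      else if h : X.Nonempty then
        (if (X.min' h, X.max' h) ∈ B then N else min (om (X.min' h)) (betaP (X.min' h) - 1))
      else (if bd = db then N else db))
    (X : Finset ℕ) (hX : V X) :
    V (X ∆ {t₂ X}) ∧ t₂ (X ∆ {t₂ X}) = t₂ X ∧ ∀ e ∈ X, e ≤ t₂ X := by
  classical
  have hN1 : 1 ≤ N - 1 := by omega
  have hNlt : N - 1 < N := by omega
  have hN0 : N ≠ 0 := by omega
  obtain ⟨b, hb⟩ : ∃ b : Finset ℕ → ℕ, ∀ Y : Finset ℕ,
      b Y = if h : Y.Nonempty then min (om (Y.min' h)) (betaP (Y.min' h) - 1) else db := ⟨_, fun _ => rfl⟩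
  obtain ⟨c, hc⟩ : ∃ c : Finset ℕ → ℕ, ∀ Y : Finset ℕ,
      c Y = if h : (Y.erase 0).Nonempty then alphaP ((Y.erase 0).min' h) else sA := ⟨_, fun _ => rfl⟩
  -- part (b') sets are in 𝒱 and t₂ = b there
  have hPartB : ∀ Y : Finset ℕ,
      ((Y = ∅ ∧ bd = db + 1) ∨ (Y.Nonempty ∧ (∀ e ∈ Y, 1 ≤ e ∧ e ≤ N - 1) ∧
        ∀ h : Y.Nonempty, Y.max' h ≤ min (om (Y.min' h)) (betaP (Y.min' h) - 1))) →
      V Y ∧ t₂ Y = b Y := by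
    intro Y hY
    rcases hY with ⟨rfl, hs⟩ | ⟨hne, hbd', hθ⟩
    · refine ⟨(hV _).mpr (Or.inl rfl), ?_⟩
      rw [ht₂, hb]
      have hs' : ¬ bd = db := by omega
      simp [hs']
    · have h0 : (0 : ℕ) ∉ Y := fun h => by have := (hbd' 0 h).1; omega
      have hNn : N ∉ Y := fun h => by have := (hbd' N h).2; omega
      have hm := hbd' _ (min'_mem Y hne)
      have hM := hbd' _ (max'_mem Y hne)
      have hmM : Y.min' hne ≤ Y.max' hne := min'_le Y _ (max'_mem Y hne)
      have hcell : (Y.min' hne, Y.max' hne) ∉ B := by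
        intro hin
        have := ((hBcol _ _).mp hin).2.2.2
        have := hθ hne
        omega
      refine ⟨(hV _).mpr (Or.inr (Or.inl ⟨hne, h0, hNn, fun e he => (hbd' e he).2, fun h => ?_⟩)), ?_⟩
      · have hh : h = hne := rfl
        rw [hh, hRrc _ _ hm.1 hmM hM.2]
        have := hθ hne
        omega
      · rw [ht₂, hb, if_neg hNn, if_neg h0, dif_pos hne, dif_pos hne, if_neg hcell]
  rw [hV] at hX
  rcases hX with rfl | ⟨hne, h0, hNn, hle, hR⟩ | ⟨h0, hNn, hle, hrest⟩ | ⟨hNX, h0, hle, hrest⟩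
  · ----------------------------------------------------------------- X = ∅
    by_cases hε : bd = db
    · have ht : t₂ ∅ = N := by rw [ht₂]; simp [hε]
      rw [ht]
      have hY : (∅ : Finset ℕ) ∆ {N} = {N} := by simp
      rw [hY]
      refine ⟨(hV _).mpr (Or.inr (Or.inr (Or.inr ⟨by simp, by simp; omega, by simp, Or.inl ⟨rfl, hε⟩⟩))), ?_,
        by simp⟩
      rw [ht₂]; simp
    · have hs : bd = db + 1 := by omega
      have hb1 := hPartB ∅ (Or.inl ⟨rfl, hs⟩)
      obtain ⟨hmem, hbb, hle'⟩ := hubStair_mu2_innerPart N om betaP bd db B hom hBcol hBdiag hBdom hbd hdb1 hdbN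
        hbdN hbetaP b hb ∅ (Or.inl ⟨rfl, hs⟩)
      have hb2 := hPartB _ hmem
      rw [hb1.2]
      exact ⟨hb2.1, by rw [hb2.2, hbb], hle'⟩
  · ----------------------------------------------------------------- inner X
    have hmin1 : 1 ≤ X.min' hne := by
      rcases Nat.eq_zero_or_pos (X.min' hne) with h | h
      · exact absurd (h ▸ min'_mem X hne) h0
      · exact h
    have hmM : X.min' hne ≤ X.max' hne := min'_le X _ (max'_mem X hne)
    have hMN : X.max' hne ≤ N - 1 := hle _ (max'_mem X hne)
    by_cases hcB : (X.min' hne, X.max' hne) ∈ B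
    · -- toggle N
      have ht : t₂ X = N := by rw [ht₂, if_neg hNn, if_neg h0, dif_pos hne, if_pos hcB]
      rw [ht, hub_symmDiff_singleton_eq_insert X N hNn]
      refine ⟨(hV _).mpr (Or.inr (Or.inr (Or.inr ⟨mem_insert_self N X, ?_, ?_, Or.inr ?_⟩))), ?_,
        fun e he => (hle e he).trans (Nat.sub_le N 1)⟩
      · rw [mem_insert]; push Not; exact ⟨hN0.symm, h0⟩
      · intro e he
        rcases mem_insert.mp he with rfl | he
        · exact le_rfl
        · exact (hle e he).trans (Nat.sub_le N 1)
      · rw [erase_insert hNn]; exact ⟨hne, hcB⟩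
      · rw [ht₂, if_pos (mem_insert_self N X)]
    · -- part (b')
      have hbd' : ∀ e ∈ X, 1 ≤ e ∧ e ≤ N - 1 := fun e he =>
        ⟨hmin1.trans (min'_le X e he), hle e he⟩
      have hθ : ∀ h : X.Nonempty, X.max' h ≤ min (om (X.min' h)) (betaP (X.min' h) - 1) := by
        intro h
        have hh : h = hne := rfl
        rw [hh]
        have h1 : X.max' hne ≤ om (X.min' hne) := (hRrc _ _ hmin1 hmM hMN).mp (hR hne)
        have h2 : ¬ (betaP (X.min' hne) ≤ X.max' hne) := by
          intro hle2
          apply hcB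
          rw [hBcol]
          exact ⟨hmin1, hmM, hMN, hle2⟩
        omega
      have hb1 := hPartB X (Or.inr ⟨hne, hbd', hθ⟩)
      obtain ⟨hmem, hbb, hle'⟩ := hubStair_mu2_innerPart N om betaP bd db B hom hBcol hBdiag hBdom hbd hdb1 hdbN
        hbdN hbetaP b hb X (Or.inr ⟨hne, hbd', hθ⟩)
      have hb2 := hPartB _ hmem
      rw [hb1.2]
      exact ⟨hb2.1, by rw [hb2.2, hbb], hle'⟩
  · ----------------------------------------------------------------- 0 ∈ X
    have ht : t₂ X = c X := by rw [ht₂, hc, if_neg hNn, if_pos h0]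
    obtain ⟨⟨h0Y, hleY, hrestY⟩, hcc, hcle⟩ := hubStair_mu2_bottomPart N alphaP sA dA A hAcol hAdiag hAdom hsd hsN
      halphaP c hc X ⟨h0, hle, hrest⟩
    rw [ht]
    have hcN : c X ≤ N - 1 := by
      rw [hc]; split_ifs
      · exact halphaP _
      · exact hsN
    have hNY : N ∉ X ∆ {c X} := by
      rw [mem_symmDiff, mem_singleton]
      rintro (⟨h, _⟩ | ⟨h, _⟩)
      · exact hNn h
      · omega
    refine ⟨(hV _).mpr (Or.inr (Or.inr (Or.inl ⟨h0Y, hNY, hleY, hrestY⟩))), ?_, hcle⟩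
    rw [ht₂, if_neg hNY, if_pos h0Y, ← hc]
    exact hcc
  · ----------------------------------------------------------------- N ∈ X
    have ht : t₂ X = N := by rw [ht₂, if_pos hNX]
    rw [ht, hub_symmDiff_singleton_eq_erase X N hNX]
    refine ⟨?_, ?_, hle⟩
    · rcases hrest with ⟨hX0, hε⟩ | ⟨hZne, hcell⟩
      · rw [hX0]; simp only [erase_singleton]
        exact (hV _).mpr (Or.inl rfl)
      · refine (hV _).mpr (Or.inr (Or.inl ⟨hZne, fun h => h0 (mem_of_mem_erase h),
          fun h => (mem_erase.mp h).1 rfl, fun e he => ?_, fun h => ?_⟩))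
        · have h1 := hle e (mem_of_mem_erase he)
          have h2 := (mem_erase.mp he).1
          omega
        · have hh : h = hZne := rfl
          rw [hh]
          exact hBR _ _ hcell
    · rcases hrest with ⟨hX0, hε⟩ | ⟨hZne, hcell⟩
      · rw [hX0]; simp only [erase_singleton]
        rw [ht₂]; simp [hε]
      · have hN' : N ∉ X.erase N := fun h => (mem_erase.mp h).1 rfl
        have h0' : (0 : ℕ) ∉ X.erase N := fun h => h0 (mem_of_mem_erase h)
        rw [ht₂, if_neg hN', if_neg h0', dif_pos hZne, if_pos hcell]

end Coefficientwise

end Summit.CriticalPhenomena.PercolationContinuityZ3.Theorems
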